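import Literature.Geometry.Kaehler.ComplexTorusNeronSeveriKunnethHom
import Literature.Geometry.Kaehler.ComplexTorusAnalyticCycleClassGraph
import Literature.Geometry.Kaehler.ComplexTorusIntersectionFormSignature
import HarnessLib

/-!
# Transport of `NS(X)`, polarisations, `∫_X` and the intersection form along a `ℂ`-linear change of presentation;
# the Euclidean product `X₁ ⊞ X₂` versus `X₁ × X₂`; `NS(E_τ × E_τ')` in the Euclidean model

Layer `Literature/Geometry/Kaehler`, namespace `Literature.Geometry.Kaehler.ComplexTorus`; lane `lit-hodgefound`, seat
p07 (generation 50), file 87 of the seat lineage (GEN-50 MENU (i), the bridge `prodPeriod ↔ prodPeriodL2`).  The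
tree presents a complex torus by a period isomorphism `Ψ : ℝ^κ ≃ F`; a `ℂ`-linear isomorphism of universal covers
`T : F ≃ F'` (real-linear with `T(c x) = c T(x)`, the convention of `ComplexTorusAnalyticCycleClassGraph` §1) gives the
presentation `Ψ.trans T` of the "same" torus, and that file transports lattice data, orientation signs, volume forms
and sub-torus data (`latticeVec_trans`, `orientationSign_trans`, `volumeForm_trans`, `SubtorusFrame.mapEquiv`).  Here
the Néron–Severi group, polarisations, the integral `∫_X` and the intersection form `Q` are transported (by pull-back
`θ ↦ T^*θ = θ ∘ (T × T)`), and the case `prodPeriodL2 Φ₁ Φ₂ = (prodPeriod Φ₁ Φ₂).trans toLp` (definitional) is spelled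
out: the files on `NS(X₁ × X₂)` by forms (82–83: `isNSForm_prodPeriod_iff`, `isNSForm_ellipticPeriod_prod_iff`) live on
`E₁ × E₂`, the files on curves and cycle classes (70–86) on the Euclidean `E₁ ⊞ E₂ = WithLp 2 (E₁ × E₂)` (which carries
the inner product the analytic-set library wants); this file lets either be used in the other model.  Theorems only
(no definition, no named fact, no instance, no notation; net Literature debt `0`).

SOURCES.  H. Lange, *Abelian Varieties over the Complex Numbers* (2023), §2.1.1 Cor. 2.1.4 (pull-back of
polarisations along homomorphisms finite onto their image — here isomorphisms); Ch. Birkenhake, H. Lange, *Complex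
Abelian Varieties* (1992), §1.2 (analytic and rational representations), §5.3 (products); J. S. Milne, *Lefschetz
classes on abelian varieties* (1999), proof of Prop. 4.1 (held text p0024): "There is a canonical decomposition
`NS(X × Y) ≅ NS(X) ⊕ NS(Y) ⊕ DC(X, Y)`"; J. Rosen, A. Shnidman (2014), Prop. 2.3 (held `paper:arxiv-1402.2233` p0006):
"`ℤ ⊕ Hom(E, E') ⊕ ℤ → NS(A)` … is an isomorphism of groups".

* §1 TRANSPORT ALONG `Ψ.trans T` (`T` `ℂ`-linear): **`isNSForm_trans_iff`** (`θ ∈ NS(Ψ.trans T) ⟺ T^*θ ∈ NS(Ψ)`),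
  **`isRiemannForm_trans_iff`**, `isAbelianVariety_trans_iff`, **`torusIntegral_trans`** (`∫_{Ψ.trans T} ω = ∫_Ψ T^*ω`),
  **`intersectionForm_trans`** (`Q_{Ψ.trans T}(α, β) = Q_Ψ(T^*α, T^*β)`).
* §2 THE EUCLIDEAN PRODUCT: `isNSForm_prodPeriodL2_iff` / `isNSForm_prodPeriod_iff_prodPeriodL2` (`NS` in the two
  models via `∘ toLp`, `∘ ofLp`), `isRiemannForm_prodPeriodL2_iff`, `intersectionForm_prodPeriodL2`,
  **`isNSForm_prodPeriodL2_iff_inl_inr`** (Milne's decomposition `NS(X₁ × X₂) = p₁^*NS ⊕ p₂^*NS ⊕ NS^{1,1}` read in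
  the Euclidean model, from file 82).
* §3 **`isNSForm_ellipticPeriod_prodL2_iff`** (`NS(E_τ × E_τ') ≅ ℤ ⊕ ℤ ⊕ Hom(E_τ', E_τ)` in the Euclidean model:
  restrictions `n₁E_τ`, `n₂E_τ'` to the axes and mixed part `θ((u,0),(0,w)) = E_τ(u, αw)`, `αΛ_τ' ⊆ Λ_τ`, from
  file 83).

## References

* [Lange2023AbelianVarietiesComplex] H. Lange, *Abelian Varieties over the Complex Numbers*, Springer (2023), §2.1.1
  Cor. 2.1.4; §6.2.4 (p. 310).
* [LangeBirkenhake1992] Ch. Birkenhake, H. Lange, *Complex Abelian Varieties*, Springer (1992), §1.2, §5.3.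
* [Milne1999LefschetzClasses] J. S. Milne, *Lefschetz classes on abelian varieties*, Duke Math. J. 96 (1999), §4
  Prop. 4.1 (proof), Cor. 4.2 (proof).
* [RosenShnidman2014NeronSeveriProductSurfaces] J. Rosen, A. Shnidman, *Néron–Severi groups of product abelian
  surfaces*, arXiv:1402.2233 (2014), §2 Prop. 2.3.
* [VoisinHodgeI2002] C. Voisin, *Hodge Theory and Complex Algebraic Geometry I* (2002), §6.3.2 Thm. 6.33.
* [Hartshorne1977] R. Hartshorne, *Algebraic Geometry* (1977), Ch. V §1.
-/

noncomputable section

set_option maxSynthPendingDepth 3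

open scoped Manifold ComplexOrder NNReal
open Complex Set Function Module WithLp

namespace Literature.Geometry.Kaehler

namespace ComplexTorus

universe u

/-! ## §1 Transport of `NS`, polarisations, `∫_X` and `Q` along a `ℂ`-linear change of presentation `Ψ.trans T` -/

section Transport

variable {κ : Type*} {F F' : Type*} [NormedAddCommGroup F] [NormedSpace ℂ F] [NormedAddCommGroup F'] [NormedSpace ℂ F']
  (Ψ : (κ → ℝ) ≃L[ℝ] F) (T : F ≃L[ℝ] F') (hT : ∀ (c : ℂ) (x : F), T (c • x) = c • T x)

/-- `(θ ∘ T)(x, y) = θ(Tx, Ty)`. [folklore] -/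
private theorem comp_pair₈₇ (θ : F' [⋀^Fin 2]→L[ℝ] ℝ) (x y : F) :
    θ.compContinuousLinearMap (T : F →L[ℝ] F') ![x, y] = θ ![T x, T y] := by
  rw [ContinuousAlternatingMap.compContinuousLinearMap_apply]
  congr 1; funext i; fin_cases i <;> rfl

include hT in
/-- **`NS` is transported by pull-back**: `θ ∈ NS` of the torus presented by `Ψ.trans T` (`T` a `ℂ`-linear
isomorphism of the universal covers carrying `Λ` to `Λ'`) iff `T^*θ = θ ∘ (T × T) ∈ NS` of the torus presented by `Ψ`.
[cite: Lange2023AbelianVarietiesComplex, §2.1.1 Cor. 2.1.4] [cite: LangeBirkenhake1992, §1.2 (analytic representations)] -/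
theorem isNSForm_trans_iff (θ : F' [⋀^Fin 2]→L[ℝ] ℝ) :
    IsNSForm (Ψ.trans T) θ ↔ IsNSForm Ψ (θ.compContinuousLinearMap (T : F →L[ℝ] F')) := by
  constructor
  · intro h
    refine ⟨fun u v ↦ ?_, fun m n ↦ ?_⟩
    · rw [comp_pair₈₇, comp_pair₈₇, hT, hT, h.type_one_one]
    · obtain ⟨k, hk⟩ := h.integral m n
      exact ⟨k, by rw [comp_pair₈₇, ← latticeVec_trans, ← latticeVec_trans, hk]⟩
  · intro h
    refine ⟨fun u v ↦ ?_, fun m n ↦ ?_⟩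
    · have h1 := h.type_one_one (T.symm u) (T.symm v)
      rw [comp_pair₈₇, comp_pair₈₇, hT, hT, T.apply_symm_apply, T.apply_symm_apply] at h1
      exact h1
    · obtain ⟨k, hk⟩ := h.integral m n
      exact ⟨k, by rw [latticeVec_trans, latticeVec_trans, ← comp_pair₈₇, hk]⟩

include hT in
/-- **Polarisations are transported by pull-back**: `θ` is a Riemann form for `Ψ.trans T` iff `T^*θ` is one for `Ψ`.
[cite: Lange2023AbelianVarietiesComplex, §2.1.1 Cor. 2.1.4] -/
theorem isRiemannForm_trans_iff (θ : F' [⋀^Fin 2]→L[ℝ] ℝ) :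
    IsRiemannForm (Ψ.trans T) θ ↔ IsRiemannForm Ψ (θ.compContinuousLinearMap (T : F →L[ℝ] F')) := by
  constructor
  · intro h
    have hNS := (isNSForm_trans_iff Ψ T hT θ).1 h.isNSForm
    refine ⟨hNS.type_one_one, hNS.integral, fun u hu ↦ ?_⟩
    rw [comp_pair₈₇, hT]
    exact h.2.2 (T u) (by simpa using hu)
  · intro h
    have hNS := (isNSForm_trans_iff Ψ T hT θ).2 h.isNSForm
    refine ⟨hNS.type_one_one, hNS.integral, fun u hu ↦ ?_⟩
    have h1 := h.2.2 (T.symm u) (by simpa using hu)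
    rw [comp_pair₈₇, hT, T.apply_symm_apply] at h1
    exact h1

include hT in
/-- `X` presented by `Ψ.trans T` is an abelian variety iff `X` presented by `Ψ` is.
[cite: Lange2023AbelianVarietiesComplex, §2.1.1 Cor. 2.1.4] -/
theorem isAbelianVariety_trans_iff : IsAbelianVariety (Ψ.trans T) ↔ IsAbelianVariety Ψ := by
  constructor
  · rintro ⟨ω, hω⟩
    exact ⟨_, (isRiemannForm_trans_iff Ψ T hT ω).1 hω⟩
  · rintro ⟨ω, hω⟩
    refine ⟨ω.compContinuousLinearMap (T.symm : F' →L[ℝ] F), (isRiemannForm_trans_iff Ψ T hT _).2 ?_⟩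
    have : (ω.compContinuousLinearMap (T.symm : F' →L[ℝ] F)).compContinuousLinearMap (T : F →L[ℝ] F') = ω := by
      ext v
      simp [ContinuousAlternatingMap.compContinuousLinearMap_apply, Function.comp_def]
    rwa [this]

variable [Fintype κ] [DecidableEq κ]

omit [Fintype κ] in
include hT in
/-- **`∫` is transported**: `∫_{X'} ω = ∫_X T^*ω` (`X' = F'/TΛ`, `X = F/Λ`; the lattice frame of `Ψ.trans T` is
`T ∘` that of `Ψ`, with the same orientation sign). [cite: Lange2023AbelianVarietiesComplex, §6.2.4 p. 310] -/
theorem torusIntegral_trans {N : ℕ} (e : Fin N ≃ κ) (ω : F' [⋀^Fin N]→L[ℝ] ℂ) :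
    torusIntegral (Ψ.trans T) e ω = torusIntegral Ψ e (ω.compContinuousLinearMap (T : F →L[ℝ] F')) := by
  rw [torusIntegral, torusIntegral, orientationSign_trans Ψ T hT, ContinuousAlternatingMap.compContinuousLinearMap_apply,
    latticeFrame_trans]
  rfl

omit [Fintype κ] in
include hT in
/-- **The intersection form is transported**: `Q_{X'}(α, β) = Q_X(T^*α, T^*β)` (`∫` and `∧` commute with pull-back).
[cite: Lange2023AbelianVarietiesComplex, §6.2.4 p. 310] [cite: VoisinHodgeI2002, §6.3.2 Thm. 6.33] -/
theorem intersectionForm_trans {g : ℕ} (e : Fin (2 * g) ≃ κ) (α β : F' [⋀^Fin g]→L[ℝ] ℝ) :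
    intersectionForm (Ψ.trans T) e α β =
      intersectionForm Ψ e (α.compContinuousLinearMap (T : F →L[ℝ] F')) (β.compContinuousLinearMap (T : F →L[ℝ] F')) := by
  rw [intersectionForm_apply, intersectionForm_apply, torusIntegral_trans Ψ T hT]
  have hα : ofRealForm (α.compContinuousLinearMap (T : F →L[ℝ] F')) = (ofRealForm α).compContinuousLinearMap (T : F →L[ℝ] F') := by
    ext w; rfl
  have hβ : ofRealForm (β.compContinuousLinearMap (T : F →L[ℝ] F')) = (ofRealForm β).compContinuousLinearMap (T : F →L[ℝ] F') := by
    ext w; rfl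
  rw [hα, hβ, ← ContinuousAlternatingMap.wedge_compContinuousLinearMap]
  rfl

end Transport

/-! ## §2 The Euclidean product `prodPeriodL2 = prodPeriod.trans toLp`: `NS`, polarisations and `Q` in both models -/

section ProdL2

variable {ι₁ ι₂ : Type*} [Fintype ι₁] [Fintype ι₂] [DecidableEq ι₁] [DecidableEq ι₂] {E₁ E₂ : Type*}
  [NormedAddCommGroup E₁] [NormedSpace ℂ E₁] [NormedAddCommGroup E₂] [NormedSpace ℂ E₂]
  (Φ₁ : (ι₁ → ℝ) ≃L[ℝ] E₁) (Φ₂ : (ι₂ → ℝ) ≃L[ℝ] E₂)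

omit [Fintype ι₁] [Fintype ι₂] [DecidableEq ι₁] [DecidableEq ι₂] in
/-- `toLp : E₁ × E₂ → E₁ ⊞ E₂` commutes with the complex scalars. [folklore] -/
private theorem toLp_complex_smul₈₇ (c : ℂ) (x : E₁ × E₂) :
    (WithLp.prodContinuousLinearEquiv 2 ℝ E₁ E₂).symm (c • x) = c • (WithLp.prodContinuousLinearEquiv 2 ℝ E₁ E₂).symm x :=
  rfl

omit [DecidableEq ι₁] [DecidableEq ι₂] in
/-- **`NS(X₁ × X₂)` in the Euclidean model = `NS` in the plain product model, via `θ ↦ θ ∘ (toLp × toLp)`.**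
[cite: LangeBirkenhake1992, §5.3 (the product torus)] [cite: Lange2023AbelianVarietiesComplex, §2.1.1 Cor. 2.1.4] -/
theorem isNSForm_prodPeriodL2_iff (θ : WithLp 2 (E₁ × E₂) [⋀^Fin 2]→L[ℝ] ℝ) :
    IsNSForm (prodPeriodL2 Φ₁ Φ₂) θ ↔ IsNSForm (prodPeriod Φ₁ Φ₂) (θ.compContinuousLinearMap
      ((WithLp.prodContinuousLinearEquiv 2 ℝ E₁ E₂).symm : E₁ × E₂ →L[ℝ] WithLp 2 (E₁ × E₂))) :=
  isNSForm_trans_iff (prodPeriod Φ₁ Φ₂) _ (toLp_complex_smul₈₇) θ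

omit [DecidableEq ι₁] [DecidableEq ι₂] in
/-- **… and conversely**, via `θ ↦ θ ∘ (ofLp × ofLp)`. [cite: LangeBirkenhake1992, §5.3] -/
theorem isNSForm_prodPeriod_iff_prodPeriodL2 (θ : (E₁ × E₂) [⋀^Fin 2]→L[ℝ] ℝ) :
    IsNSForm (prodPeriod Φ₁ Φ₂) θ ↔ IsNSForm (prodPeriodL2 Φ₁ Φ₂) (θ.compContinuousLinearMap
      (WithLp.prodContinuousLinearEquiv 2 ℝ E₁ E₂ : WithLp 2 (E₁ × E₂) →L[ℝ] E₁ × E₂)) := by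
  rw [isNSForm_prodPeriodL2_iff]
  have h : (θ.compContinuousLinearMap (WithLp.prodContinuousLinearEquiv 2 ℝ E₁ E₂ : WithLp 2 (E₁ × E₂) →L[ℝ] E₁ × E₂)).compContinuousLinearMap
      ((WithLp.prodContinuousLinearEquiv 2 ℝ E₁ E₂).symm : E₁ × E₂ →L[ℝ] WithLp 2 (E₁ × E₂)) = θ := by
    ext v; rfl
  rw [h]

omit [DecidableEq ι₁] [DecidableEq ι₂] in
/-- **Polarisations of `X₁ × X₂` in the two models correspond** via `θ ↦ θ ∘ (toLp × toLp)`.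
[cite: Lange2023AbelianVarietiesComplex, §2.1.1 Cor. 2.1.4] -/
theorem isRiemannForm_prodPeriodL2_iff (θ : WithLp 2 (E₁ × E₂) [⋀^Fin 2]→L[ℝ] ℝ) :
    IsRiemannForm (prodPeriodL2 Φ₁ Φ₂) θ ↔ IsRiemannForm (prodPeriod Φ₁ Φ₂) (θ.compContinuousLinearMap
      ((WithLp.prodContinuousLinearEquiv 2 ℝ E₁ E₂).symm : E₁ × E₂ →L[ℝ] WithLp 2 (E₁ × E₂))) :=
  isRiemannForm_trans_iff (prodPeriod Φ₁ Φ₂) _ (toLp_complex_smul₈₇) θ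

/-- **`Q` in the two models**: `Q_{L2}(α, β) = Q(α ∘ toLp, β ∘ toLp)`. [cite: VoisinHodgeI2002, §6.3.2 Thm. 6.33] -/
theorem intersectionForm_prodPeriodL2 {g : ℕ} (e : Fin (2 * g) ≃ ι₁ ⊕ ι₂) (α β : WithLp 2 (E₁ × E₂) [⋀^Fin g]→L[ℝ] ℝ) :
    intersectionForm (prodPeriodL2 Φ₁ Φ₂) e α β =
      intersectionForm (prodPeriod Φ₁ Φ₂) e
        (α.compContinuousLinearMap ((WithLp.prodContinuousLinearEquiv 2 ℝ E₁ E₂).symm : E₁ × E₂ →L[ℝ] WithLp 2 (E₁ × E₂)))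
        (β.compContinuousLinearMap ((WithLp.prodContinuousLinearEquiv 2 ℝ E₁ E₂).symm : E₁ × E₂ →L[ℝ] WithLp 2 (E₁ × E₂))) :=
  intersectionForm_trans (prodPeriod Φ₁ Φ₂) _ (toLp_complex_smul₈₇) e α β

/-- **`NS(X₁ × X₂) = p₁^*NS(X₁) ⊕ p₂^*NS(X₂) ⊕ NS^{1,1}` in the Euclidean model** (file 82's `isNSForm_prodPeriod_iff`
transported): `θ ∈ NS(X₁ ⊞ X₂)` iff `ι₁^*θ ∈ NS(X₁)`, `ι₂^*θ ∈ NS(X₂)` (`ιᵢ` the Euclidean inclusions `u ↦ (u, 0)`,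
`w ↦ (0, w)`) and the cross part `θ ∘ toLp − (p₁^*ι₁^*θ + p₂^*ι₂^*θ)` is in `NS(X₁ × X₂)`.
[cite: Milne1999LefschetzClasses, §4 Prop. 4.1 (proof) ("a canonical decomposition `NS(X × Y) ≅ NS(X) ⊕ NS(Y) ⊕ DC(X, Y)`")] -/
theorem isNSForm_prodPeriodL2_iff_inl_inr (θ : WithLp 2 (E₁ × E₂) [⋀^Fin 2]→L[ℝ] ℝ) :
    IsNSForm (prodPeriodL2 Φ₁ Φ₂) θ ↔
      IsNSForm Φ₁ (θ.compContinuousLinearMap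
          (((WithLp.prodContinuousLinearEquiv 2 ℝ E₁ E₂).symm : E₁ × E₂ →L[ℝ] WithLp 2 (E₁ × E₂)).comp
            (ContinuousLinearMap.inl ℝ E₁ E₂))) ∧
        IsNSForm Φ₂ (θ.compContinuousLinearMap
          (((WithLp.prodContinuousLinearEquiv 2 ℝ E₁ E₂).symm : E₁ × E₂ →L[ℝ] WithLp 2 (E₁ × E₂)).comp
            (ContinuousLinearMap.inr ℝ E₁ E₂))) ∧
          IsNSForm (prodPeriod Φ₁ Φ₂)
            (θ.compContinuousLinearMap ((WithLp.prodContinuousLinearEquiv 2 ℝ E₁ E₂).symm : E₁ × E₂ →L[ℝ] WithLp 2 (E₁ × E₂)) -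
              prodForm
                (θ.compContinuousLinearMap
                  (((WithLp.prodContinuousLinearEquiv 2 ℝ E₁ E₂).symm : E₁ × E₂ →L[ℝ] WithLp 2 (E₁ × E₂)).comp
                    (ContinuousLinearMap.inl ℝ E₁ E₂)))
                (θ.compContinuousLinearMap
                  (((WithLp.prodContinuousLinearEquiv 2 ℝ E₁ E₂).symm : E₁ × E₂ →L[ℝ] WithLp 2 (E₁ × E₂)).comp
                    (ContinuousLinearMap.inr ℝ E₁ E₂)))) := by
  rw [isNSForm_prodPeriodL2_iff, isNSForm_prodPeriod_iff]
  constructor <;> rintro ⟨h₁, h₂, h₃⟩ <;> exact ⟨h₁, h₂, h₃⟩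

end ProdL2

/-! ## §3 `NS(E_τ × E_τ') ≅ ℤ ⊕ ℤ ⊕ Hom(E_τ', E_τ)` in the Euclidean model -/

section Elliptic

variable {τ : ℂ} (hτ : τ.im ≠ 0) {τ' : ℂ} (hτ' : τ'.im ≠ 0)

include hτ hτ' in
/-- **`NS(E_τ × E_τ')` in the Euclidean model `ℂ ⊞ ℂ / (Λ_τ ⊕ Λ_τ')`** (file 83's `isNSForm_ellipticPeriod_prod_iff`
transported along `toLp`): a real `2`-form `θ` on `ℂ ⊞ ℂ` is a Néron–Severi class of `E_τ × E_τ'` iff its restrictions to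
the axes are `n₁ E_τ`, `n₂ E_τ'` (`nᵢ ∈ ℤ`) and its mixed part is `θ((u,0),(0,w)) = E_τ(u, αw)` for an
`α ∈ Hom(E_τ', E_τ) = {α : αΛ_τ' ⊆ Λ_τ}` — the model in which the curves `h, v, Γ_λ` of files 70–85 live.
[cite: RosenShnidman2014NeronSeveriProductSurfaces, §2 Prop. 2.3] [cite: Milne1999LefschetzClasses, §4 Cor. 4.2 (proof)] -/
theorem isNSForm_ellipticPeriod_prodL2_iff (θ : WithLp 2 (ℂ × ℂ) [⋀^Fin 2]→L[ℝ] ℝ) :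
    IsNSForm (prodPeriodL2 (ellipticPeriod hτ) (ellipticPeriod hτ')) θ ↔
      (∃ n₁ : ℤ, θ.compContinuousLinearMap
          (((WithLp.prodContinuousLinearEquiv 2 ℝ ℂ ℂ).symm : ℂ × ℂ →L[ℝ] WithLp 2 (ℂ × ℂ)).comp
            (ContinuousLinearMap.inl ℝ ℂ ℂ)) = n₁ • ellipticForm hτ) ∧
        (∃ n₂ : ℤ, θ.compContinuousLinearMap
          (((WithLp.prodContinuousLinearEquiv 2 ℝ ℂ ℂ).symm : ℂ × ℂ →L[ℝ] WithLp 2 (ℂ × ℂ)).comp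
            (ContinuousLinearMap.inr ℝ ℂ ℂ)) = n₂ • ellipticForm hτ') ∧
          ∃ α : ℂ, (∀ m : Fin 2 → ℤ, ∃ n : Fin 2 → ℤ,
              α * latticeVec (ellipticPeriod hτ') m = latticeVec (ellipticPeriod hτ) n) ∧
            ∀ u w : ℂ, θ ![toLp 2 (u, 0), toLp 2 (0, w)] = ellipticForm hτ ![u, α * w] := by
  rw [isNSForm_prodPeriodL2_iff, isNSForm_ellipticPeriod_prod_iff hτ hτ']
  have hpair : ∀ u w : ℂ, θ.compContinuousLinearMap
      ((WithLp.prodContinuousLinearEquiv 2 ℝ ℂ ℂ).symm : ℂ × ℂ →L[ℝ] WithLp 2 (ℂ × ℂ)) ![(u, 0), (0, w)] =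
        θ ![toLp 2 (u, 0), toLp 2 (0, w)] := fun u w ↦ by
    rw [ContinuousAlternatingMap.compContinuousLinearMap_apply]
    congr 1; funext i; fin_cases i <;> rfl
  simp only [hpair]
  exact Iff.rfl

end Elliptic


end ComplexTorus

end Literature.Geometry.Kaehler
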